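import Literature.AnabelianGeometry.EtaleTheta.BarDeltaOfSetting
import Literature.AnabelianGeometry.EtaleTheta.LDeltaThetaIndex
import Literature.AnabelianGeometry.EtaleTheta.Discharge.Sec2DeltaThetaTorsionFree
import HarnessLib

/-!
# [EtTh] §2 over §1: "`Δ̄_Θ ≅ (ℤ/lℤ)(1)`" — the index `[Δ̄_Θ-preimage : Ker(Δ^tp_X ↠ Δ̄_X)] = l` at the
# §1 model, from the freeness guard (proof-only; W3-L2-02 phase 1, numerology part 1)

Mochizuki, *The étale theta function and its Frobenioid-theoretic manifestations*, Publ. RIMS **45**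
(2009), §2 p. 35 (printed 261): "`1 → Δ̄_Θ → Δ̄_X → Δ̄^ell_X → 1`, where `Δ̄_Θ ≅ (ℤ/lℤ)(1)`"
[cite: MochizukiEtTh2009, Def 2.1 p.35]; §1 p. 12: "`Δ_X ↠ Δ^ell_X = Δ^ab_X = Δ_X/[Δ_X, Δ_X]`", `Δ_X` "a
profinite free group on 2 generators".

Cell abc-iut, layer L2, plan/L2/ASSIGNMENTS.md §J row W3-L2-02, PHASE 1 continued (seat abc-iut-L2-d3):
PROOF-ONLY companion (no `def`, no new named fact) of `BarDeltaOfSetting.lean` (`powTheta`, `barKerTp`,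
`barThetaTp`). For `D : ThetaSetting p` under the vacuity guard `D.IsEtThOrigin` and `l` ODD
(ERRATUM E1, [IUTchI] Rmk. 3.1.6):

* `mem_commutatorClosure_of_pow_mem` — **the profinite abelianisation `Δ^ell_X = Δ_X/[Δ_X,Δ_X]⁻` is
  torsion-free**: `c ∈ Δ_X`, `n ≥ 1`, `c^n ∈ [Δ_X,Δ_X]⁻ ⇒ c ∈ [Δ_X,Δ_X]⁻` (finite ABELIAN quotients
  `(ℤ/nN₀)²` of the free pair and separation by open normal subgroups — the abelian analogue of
  `Sec2DeltaThetaTorsionFree.mem_tripleCommutatorClosure_of_pow_mem`); hence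
  `mem_deltaTheta_of_pow_mem`: `(Δ^tp_X)^ell = (Δ^tp_X)^Θ/Δ_Θ` has no torsion;
* `exists_pow_mul_of_mem_powTheta` — in the class-two group `(Δ^tp_X)^Θ`, for `l` odd, every element
  of `⟨l-th powers⟩` is `t^l · z` with `z ∈ l·Δ_Θ` (`(ts)^l = t^l s^l [s,t]^{l(l-1)/2}`,
  `mul_pow_eq_pow_mul_pow_mul_commutator_pow`);
* `deltaTheta_inf_powTheta` — **`Δ_Θ ∩ ⟨l-th powers⟩ = l·Δ_Θ`**;
* `relIndex_barKerTp_barThetaTp` — **`[Δ̄_Θ-preimage : Ker(Δ^tp_X ↠ Δ̄_X)] = [Δ_Θ : l·Δ_Θ]`**, and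
  `= l` given the cyclotome identification `μ : CyclotomeMod 1 l` of `ThetaCyclotomes.lean`
  (`index_lDeltaTheta_of_cyclotomeMod`) — the field `CoverData.relIndex_barKer` at the model, tempered form.

NOT here: `Δ̄^ell_X ≅ (ℤ/lℤ)²` (`CoverData.ell_rank_two` at the model) — it needs
`#((Δ^tp_Y)^ell ⊗ ℤ/l) = l` ("`Δ^tp_Y/Δ^tp_{Y_N} ≅ ℤ/Nℤ(1)`", p. 16), which the root interface
`ThetaSetting` does not determine (its axioms on `GtpYN` fix the index of `Π^tp_{Y_N}`, not its
position; cf. `Thm16Sub.GtpYNFromCusp`); recorded in HOME/…/W3-L2-02-CENSUS.md as input P-C9.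
HONEST FRAMING: [EtTh] is refereed; nothing is asserted about an actual curve; no side is taken on
[IUTchIII] Cor. 3.12; typed ≠ proved.
-/

noncomputable section

namespace Literature.AnabelianGeometry.EtaleTheta

open Literature.AnabelianGeometry.SemiGraphs Topology
open DtpYAbelian

/-! ### Two elementary lemmas -/

/-- In any group, an element of the subgroup generated by a COMMUTING pair `u, v` is `u^i v^j`.
[cite: MagnusKarrassSolitar1966, §1.3] -/
theorem exists_zpow_mul_zpow_of_mem_closure_pair {G : Type*} [Group G] {u v : G}
    (huv : Commute u v) {g : G} (hg : g ∈ Subgroup.closure ({u, v} : Set G)) :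
    ∃ i j : ℤ, g = u ^ i * v ^ j := by
  induction hg using Subgroup.closure_induction with
  | mem x hx =>
    rcases hx with rfl | hx
    · exact ⟨1, 0, by simp⟩
    · rw [Set.mem_singleton_iff] at hx
      subst hx
      exact ⟨0, 1, by simp⟩
  | one => exact ⟨0, 0, by simp⟩
  | mul x y _ _ hx hy =>
    obtain ⟨i, j, rfl⟩ := hx
    obtain ⟨i', j', rfl⟩ := hy
    refine ⟨i + i', j + j', ?_⟩
    have hc : Commute (v ^ j) (u ^ i') := (huv.symm.zpow_zpow j i')
    calc u ^ i * v ^ j * (u ^ i' * v ^ j') = u ^ i * (v ^ j * u ^ i') * v ^ j' := by group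
      _ = u ^ i * (u ^ i' * v ^ j) * v ^ j' := by rw [hc.eq]
      _ = u ^ (i + i') * v ^ (j + j') := by rw [zpow_add, zpow_add]; group
  | inv x _ hx =>
    obtain ⟨i, j, rfl⟩ := hx
    refine ⟨-i, -j, ?_⟩
    have hc : Commute (v ^ (-j)) (u ^ (-i)) := (huv.symm.zpow_zpow (-j) (-i))
    rw [mul_inv_rev, ← zpow_neg, ← zpow_neg, hc.eq]

namespace ThetaSetting

variable {p : ℕ} [Fact p.Prime] (D : ThetaSetting p)

/-! ### The profinite abelianisation `Δ_X/[Δ_X,Δ_X]⁻` is torsion-free (from the freeness guard) -/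

/-- **`Δ^ell_X = Δ_X/[Δ_X,Δ_X]⁻` is torsion-free** ("`Δ_X` is a profinite free group on 2 generators",
p. 12): if `c ∈ Δ_X` and `c^n ∈ [Δ_X,Δ_X]⁻` for some `n ≥ 1`, then `c ∈ [Δ_X,Δ_X]⁻`. Proof: `[Δ_X,Δ_X]⁻`
is the intersection of the `[Δ_X,Δ_X]⁻·U`, `U ⊴ Π_X` open; for such `U` put `N₀ = #(Π_X/[Δ_X,Δ_X]⁻U)` and
map the free pair `a, b` to the standard basis of `(ℤ/nN₀)²` by a continuous `F` (universal property),
which kills `[Δ_X,Δ_X]⁻`; modulo the open kernel, `c = a^i b^j`, so `F(c^n) = (ni, nj) = 0` forces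
`N₀ ∣ i, j`, whence `c ≡ a^i b^j ≡ 1` modulo `[Δ_X,Δ_X]⁻U`. [cite: MochizukiEtTh2009, §1 p.12] -/
theorem mem_commutatorClosure_of_pow_mem (hO : D.IsEtThOrigin) {c : D.PiHat} (hcΔ : c ∈ D.DeltaHat)
    {n : ℕ} (hn : n ≠ 0) (hcn : c ^ n ∈ (⁅D.DeltaHat, D.DeltaHat⁆).topologicalClosure) :
    c ∈ (⁅D.DeltaHat, D.DeltaHat⁆).topologicalClosure := by
  classical
  haveI : CompactSpace D.PiHat := D.isProfiniteCompletion_toHat.compactSpace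
  haveI : TotallyDisconnectedSpace D.PiHat := D.isProfiniteCompletion_toHat.totallyDisconnectedSpace
  haveI hΔn : D.DeltaHat.Normal := SettingCompletion.deltaHat_normal D.toTemperedCurve
  haveI hK₂n : (⁅D.DeltaHat, D.DeltaHat⁆).topologicalClosure.Normal :=
    Subgroup.is_normal_topologicalClosure _
  have hK₂closed : IsClosed
      (((⁅D.DeltaHat, D.DeltaHat⁆).topologicalClosure : Subgroup D.PiHat) : Set D.PiHat) :=
    Subgroup.isClosed_topologicalClosure _
  -- the free pair
  obtain ⟨hcpt, _, _, a, b, huniv⟩ := hO.deltaHat_free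
  haveI : CompactSpace D.DeltaHat := hcpt
  have hmapTop : (⊤ : Subgroup D.DeltaHat).map D.DeltaHat.subtype = D.DeltaHat := by
    rw [← MonoidHom.range_eq_map, Subgroup.range_subtype]
  have hmap2 : (⁅(⊤ : Subgroup D.DeltaHat), (⊤ : Subgroup D.DeltaHat)⁆ : Subgroup D.DeltaHat).map
      D.DeltaHat.subtype = ⁅D.DeltaHat, D.DeltaHat⁆ := by
    rw [Subgroup.map_commutator, hmapTop]
  -- (1) separation
  refine mem_of_forall_mem_sup _ hK₂closed fun U => ?_
  let M' : Subgroup D.PiHat := (⁅D.DeltaHat, D.DeltaHat⁆).topologicalClosure ⊔ U.toSubgroup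
  haveI hM'n : M'.Normal := inferInstance
  have hM'o : IsOpen (M' : Set D.PiHat) :=
    Subgroup.isOpen_mono (le_sup_right : U.toSubgroup ≤ M') U.toOpenSubgroup.isOpen
  haveI : Finite (D.PiHat ⧸ M') := Subgroup.quotient_finite_of_isOpen M' hM'o
  haveI : DiscreteTopology (D.PiHat ⧸ M') := QuotientGroup.discreteTopology hM'o
  have hN₀ : Nat.card (D.PiHat ⧸ M') ≠ 0 := Nat.card_pos.ne'
  -- (2) the finite abelian group `(ℤ/m)²`, `m = n · #(Π_X/M')`
  set m : ℕ := n * Nat.card (D.PiHat ⧸ M') with hm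
  haveI : NeZero m := ⟨mul_ne_zero hn hN₀⟩
  letI : TopologicalSpace (Multiplicative (ZMod m × ZMod m)) := ⊥
  haveI : DiscreteTopology (Multiplicative (ZMod m × ZMod m)) := ⟨rfl⟩
  let xq : Multiplicative (ZMod m × ZMod m) := Multiplicative.ofAdd (1, 0)
  let yq : Multiplicative (ZMod m × ZMod m) := Multiplicative.ofAdd (0, 1)
  obtain ⟨F, ⟨hFa, hFb⟩, -⟩ := huniv (Multiplicative (ZMod m × ZMod m)) xq yq
  -- `F` kills `[Δ_X,Δ_X]⁻` (abelian discrete target; closed kernel)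
  have hFker : ∀ q : D.DeltaHat,
      (q : D.PiHat) ∈ (⁅D.DeltaHat, D.DeltaHat⁆).topologicalClosure → F q = 1 := by
    intro q hq
    have hsub : ((⁅(⊤ : Subgroup D.DeltaHat), (⊤ : Subgroup D.DeltaHat)⁆ : Subgroup D.DeltaHat) :
        Set D.DeltaHat) ⊆ (F.toMonoidHom.ker : Set D.DeltaHat) := by
      intro z hz
      rw [SetLike.mem_coe, MonoidHom.mem_ker]
      exact Abelianization.commutator_subset_ker F.toMonoidHom hz
    have hkerClosed : IsClosed (F.toMonoidHom.ker : Set D.DeltaHat) := by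
      have : (F.toMonoidHom.ker : Set D.DeltaHat) = F ⁻¹' {1} := by
        ext z; simp [MonoidHom.mem_ker]
      rw [this]
      exact (isClosed_discrete _).preimage F.continuous_toFun
    have hemb : _root_.Topology.IsEmbedding (Subtype.val : D.DeltaHat → D.PiHat) :=
      _root_.Topology.IsEmbedding.subtypeVal
    have hq' : q ∈ closure ((⁅(⊤ : Subgroup D.DeltaHat), (⊤ : Subgroup D.DeltaHat)⁆ :
        Subgroup D.DeltaHat) : Set D.DeltaHat) := by
      rw [hemb.closure_eq_preimage_closure_image, Set.mem_preimage]
      have himg : (Subtype.val : D.DeltaHat → D.PiHat) ''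
          ((⁅(⊤ : Subgroup D.DeltaHat), (⊤ : Subgroup D.DeltaHat)⁆ : Subgroup D.DeltaHat) :
            Set D.DeltaHat) = ((⁅D.DeltaHat, D.DeltaHat⁆ : Subgroup D.PiHat) : Set D.PiHat) := by
        rw [← hmap2]; rfl
      rw [himg]
      exact hq
    have := (hkerClosed.closure_subset_iff.mpr hsub) hq'
    simpa [MonoidHom.mem_ker] using this
  -- the open normal subgroup `W = (M' ∩ Δ_X) ∩ Ker F` of `Δ_X` and the generation of `Δ_X` modulo `W`
  let W : Subgroup D.DeltaHat := M'.subgroupOf D.DeltaHat ⊓ F.toMonoidHom.ker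
  haveI : (M'.subgroupOf D.DeltaHat).Normal := hM'n.subgroupOf _
  haveI : W.Normal := inferInstance
  have hWo : IsOpen (W : Set D.DeltaHat) := by
    refine IsOpen.inter (hM'o.preimage continuous_subtype_val) ?_
    have : (F.toMonoidHom.ker : Set D.DeltaHat) = F ⁻¹' {1} := by
      ext z; simp [MonoidHom.mem_ker]
    change IsOpen (F.toMonoidHom.ker : Set D.DeltaHat)
    rw [this]
    exact (isOpen_discrete _).preimage F.continuous_toFun
  obtain ⟨s, hs, hsW⟩ := exists_mem_closure_pair_inv_mul_mem huniv W hWo ⟨c, hcΔ⟩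
  -- `Φ = (mod M', F)`
  let π : D.DeltaHat →* D.PiHat ⧸ M' := (QuotientGroup.mk' M').comp D.DeltaHat.subtype
  let Φ : D.DeltaHat →* (D.PiHat ⧸ M') × Multiplicative (ZMod m × ZMod m) := π.prod F.toMonoidHom
  have hΦ_fst : ∀ q : D.DeltaHat, (Φ q).1 = QuotientGroup.mk' M' (q : D.PiHat) := fun q => rfl
  have hΦ_snd : ∀ q : D.DeltaHat, (Φ q).2 = F q := fun q => rfl
  have hfst : ∀ (q : (D.PiHat ⧸ M') × Multiplicative (ZMod m × ZMod m)) (k : ℤ),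
      (q ^ k).1 = q.1 ^ k := fun q k => map_zpow (MonoidHom.fst _ _) q k
  have hsnd : ∀ (q : (D.PiHat ⧸ M') × Multiplicative (ZMod m × ZMod m)) (k : ℤ),
      (q ^ k).2 = q.2 ^ k := fun q k => map_zpow (MonoidHom.snd _ _) q k
  -- `Φ a` and `Φ b` commute (`[a, b] ∈ [Δ_X,Δ_X] ⊆ M'`; the second factor is commutative)
  have hπab : π a * π b = π b * π a := by
    rw [← mul_inv_eq_one, ← map_mul, ← map_mul, ← map_inv, ← map_mul]
    have e : a * b * (b * a)⁻¹ = a * b * a⁻¹ * b⁻¹ := by group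
    rw [e]
    change QuotientGroup.mk' M' ((a * b * a⁻¹ * b⁻¹ : D.DeltaHat) : D.PiHat) = 1
    rw [QuotientGroup.mk'_apply, QuotientGroup.eq_one_iff]
    refine Subgroup.mem_sup_left (Subgroup.le_topologicalClosure _ ?_)
    have h := Subgroup.commutator_mem_commutator a.2 b.2
    rw [commutatorElement_def] at h
    simpa using h
  have hcomm : Commute (Φ a) (Φ b) := by
    refine Prod.ext ?_ ?_
    · change (Φ a).1 * (Φ b).1 = (Φ b).1 * (Φ a).1
      rw [hΦ_fst, hΦ_fst]
      exact hπab
    · change (Φ a).2 * (Φ b).2 = (Φ b).2 * (Φ a).2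
      exact mul_comm _ _
  -- `Φ c = Φ s = (Φ a)^i (Φ b)^j`
  have hΦs : Φ s ∈ Subgroup.closure ({Φ a, Φ b} : Set _) := by
    have h := Subgroup.mem_map_of_mem Φ hs
    rw [MonoidHom.map_closure, Set.image_pair] at h
    exact h
  obtain ⟨i, j, hij⟩ := exists_zpow_mul_zpow_of_mem_closure_pair hcomm hΦs
  have hΦw : Φ (s⁻¹ * ⟨c, hcΔ⟩) = 1 := by
    refine Prod.ext ?_ ?_
    · rw [hΦ_fst, Prod.fst_one, QuotientGroup.mk'_apply, QuotientGroup.eq_one_iff]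
      have h1 := (Subgroup.mem_inf.1 hsW).1
      rw [Subgroup.mem_subgroupOf] at h1
      exact h1
    · rw [hΦ_snd, Prod.snd_one]
      exact (Subgroup.mem_inf.1 hsW).2
  have hΦc : Φ ⟨c, hcΔ⟩ = Φ a ^ i * Φ b ^ j := by
    have e : (⟨c, hcΔ⟩ : D.DeltaHat) = s * (s⁻¹ * ⟨c, hcΔ⟩) := by group
    rw [e, map_mul, hΦw, mul_one, hij]
  -- second component: `F(c^n) = 1` forces `N₀ ∣ i` and `N₀ ∣ j`
  have hFc : F ⟨c, hcΔ⟩ = Multiplicative.ofAdd (((i : ZMod m)), ((j : ZMod m))) := by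
    have h := congrArg Prod.snd hΦc
    rw [hΦ_snd, Prod.snd_mul, hsnd, hsnd, hΦ_snd, hΦ_snd, hFa, hFb] at h
    rw [h]
    change Multiplicative.ofAdd ((1 : ZMod m), (0 : ZMod m)) ^ i *
      Multiplicative.ofAdd ((0 : ZMod m), (1 : ZMod m)) ^ j = _
    rw [← ofAdd_zsmul, ← ofAdd_zsmul, ← ofAdd_add]
    congr 1
    ext <;> simp
  have hFcn : F (⟨c, hcΔ⟩ ^ n) = 1 := hFker _ (by simpa using hcn)
  have hdiv : (m : ℤ) ∣ n * i ∧ (m : ℤ) ∣ n * j := by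
    rw [map_pow, hFc, ← ofAdd_nsmul] at hFcn
    have h0 : n • (((i : ZMod m)), ((j : ZMod m))) = 0 := by
      simpa using congrArg Multiplicative.toAdd hFcn
    rw [Prod.ext_iff] at h0
    obtain ⟨h1, h2⟩ := h0
    simp only [nsmul_eq_mul, Prod.fst_zero, Prod.snd_zero] at h1 h2
    constructor
    · rw [← ZMod.intCast_zmod_eq_zero_iff_dvd]; push_cast; exact h1
    · rw [← ZMod.intCast_zmod_eq_zero_iff_dvd]; push_cast; exact h2
  have hN₀i : (Nat.card (D.PiHat ⧸ M') : ℤ) ∣ i := by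
    have h := hdiv.1
    rw [hm, Nat.cast_mul] at h
    exact (mul_dvd_mul_iff_left (by exact_mod_cast hn)).mp h
  have hN₀j : (Nat.card (D.PiHat ⧸ M') : ℤ) ∣ j := by
    have h := hdiv.2
    rw [hm, Nat.cast_mul] at h
    exact (mul_dvd_mul_iff_left (by exact_mod_cast hn)).mp h
  -- first component: `c ≡ a^i b^j ≡ 1 (mod M')`, as `#(Π_X/M') ∣ i, j`
  obtain ⟨i', rfl⟩ := hN₀i
  obtain ⟨j', rfl⟩ := hN₀j
  have h1 := congrArg Prod.fst hΦc
  rw [hΦ_fst, Prod.fst_mul, hfst, hfst, hΦ_fst, hΦ_fst, mul_comm (_ : ℤ) i',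
    mul_comm (_ : ℤ) j', zpow_mul, zpow_mul, zpow_natCast, zpow_natCast, pow_card_eq_one',
    pow_card_eq_one', mul_one, QuotientGroup.mk'_apply, QuotientGroup.eq_one_iff] at h1
  exact h1

/-- **`(Δ^tp_X)^ell` is torsion-free**, tempered form: for `t ∈ (Δ^tp_X)^Θ`, `n ≥ 1`, `t^n ∈ Δ_Θ`
implies `t ∈ Δ_Θ` (`Ker(Π^tp_X ↠ (Π^tp_X)^ell)` is the pull-back of `[Δ_X,Δ_X]⁻`, root field `ker_toEll`).
[cite: MochizukiEtTh2009, §1 p.12] -/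
theorem mem_deltaTheta_of_pow_mem (hO : D.IsEtThOrigin) {t : D.GtpTheta} (ht : t ∈ D.DtpTheta)
    {n : ℕ} (hn : n ≠ 0) (htn : t ^ n ∈ D.DeltaTheta) : t ∈ D.DeltaTheta := by
  obtain ⟨x, hx, rfl⟩ := ht
  have hxΔ : D.toHat.toMonoidHom x ∈ D.DeltaHat := by
    rw [← D.comap_toHat_deltaHat] at hx; exact hx
  have hker : x ^ n ∈ (D.thetaToEll.comp D.toTheta).ker := by
    rw [MonoidHom.mem_ker, MonoidHom.comp_apply, map_pow]
    exact htn
  rw [D.ker_toEll, Subgroup.mem_comap, map_pow] at hker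
  have hmem := D.mem_commutatorClosure_of_pow_mem hO hxΔ hn hker
  have : x ∈ (D.thetaToEll.comp D.toTheta).ker := by
    rw [D.ker_toEll, Subgroup.mem_comap]; exact hmem
  exact this

/-! ### `⟨l-th powers⟩` in the class-two group `(Δ^tp_X)^Θ`, `l` odd -/

/-- In the class-two group `(Δ^tp_X)^Θ`: `(t s)^n = t^n s^n [s,t]^{n(n-1)/2}`, `[s,t] = s t s⁻¹ t⁻¹ ∈ Δ_Θ`
central. [cite: MochizukiEtTh2009, §1 p.12] -/
theorem mul_pow_eq_pow_mul_pow_mul_commutator_pow {t s : D.GtpTheta} (ht : t ∈ D.DtpTheta)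
    (hs : s ∈ D.DtpTheta) (n : ℕ) :
    (t * s) ^ n = t ^ n * s ^ n * (s * t * s⁻¹ * t⁻¹) ^ (n.choose 2) := by
  set c := s * t * s⁻¹ * t⁻¹ with hc
  have hcΘ : c ∈ D.DeltaTheta := D.commutator_mem_deltaTheta hs ht
  have hct : Commute c t := D.deltaTheta_comm_dtpTheta hcΘ ht
  have hcs : Commute c s := D.deltaTheta_comm_dtpTheta hcΘ hs
  induction n with
  | zero => simp
  | succ n ih =>
    have hA : s ^ n * t = c ^ n * t * s ^ n := D.pow_mul_eq_commutator_pow_mul hs ht n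
    have h2 : (n + 1).choose 2 = n + n.choose 2 := by
      rw [Nat.choose_succ_succ, Nat.choose_one_right]
    calc (t * s) ^ (n + 1) = (t * s) ^ n * (t * s) := pow_succ _ _
      _ = t ^ n * s ^ n * c ^ (n.choose 2) * (t * s) := by rw [ih]
      _ = t ^ n * (s ^ n * t) * s * c ^ (n.choose 2) := by
          have e1 : Commute (c ^ (n.choose 2)) (t * s) := (hct.mul_right hcs).pow_left _
          rw [mul_assoc (t ^ n * s ^ n), e1.eq]; group
      _ = t ^ n * (c ^ n * t * s ^ n) * s * c ^ (n.choose 2) := by rw [hA]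
      _ = c ^ n * (t ^ n * t) * (s ^ n * s) * c ^ (n.choose 2) := by
          have e2 : Commute (t ^ n) (c ^ n) := (hct.symm.pow_pow n n)
          calc t ^ n * (c ^ n * t * s ^ n) * s * c ^ (n.choose 2)
              = (t ^ n * c ^ n) * t * s ^ n * s * c ^ (n.choose 2) := by group
            _ = (c ^ n * t ^ n) * t * s ^ n * s * c ^ (n.choose 2) := by rw [e2.eq]
            _ = c ^ n * (t ^ n * t) * (s ^ n * s) * c ^ (n.choose 2) := by group
      _ = t ^ (n + 1) * s ^ (n + 1) * c ^ ((n + 1).choose 2) := by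
          rw [pow_succ t n, pow_succ s n, h2, pow_add]
          have e3 : Commute (c ^ n) (t ^ n * t * (s ^ n * s)) :=
            (((hct.pow_right n).mul_right hct).mul_right ((hcs.pow_right n).mul_right hcs)).pow_left n
          calc c ^ n * (t ^ n * t) * (s ^ n * s) * c ^ n.choose 2
              = (c ^ n * (t ^ n * t * (s ^ n * s))) * c ^ n.choose 2 := by group
            _ = ((t ^ n * t * (s ^ n * s)) * c ^ n) * c ^ n.choose 2 := by rw [e3.eq]
            _ = t ^ n * t * (s ^ n * s) * (c ^ n * c ^ n.choose 2) := by group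

variable (l : ℕ)

/-- **Normal form of `⟨l-th powers⟩` for `l` odd**: every element of the subgroup of `(Δ^tp_X)^Θ`
generated by `l`-th powers is `t^l · z` with `t ∈ (Δ^tp_X)^Θ` and `z ∈ l·Δ_Θ` — products of `l`-th powers
are `l`-th powers up to `[s,t]^{l(l-1)/2} = ([s,t]^{(l-1)/2})^l ∈ l·Δ_Θ`. [cite: MochizukiEtTh2009, Def 2.1 p.35] -/
theorem exists_pow_mul_of_mem_powTheta (hl : Odd l) {q : D.GtpTheta} (hq : q ∈ D.powTheta l) :
    ∃ t ∈ D.DtpTheta, ∃ z ∈ D.lDeltaTheta l, q = t ^ l * z := by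
  obtain ⟨k, hk⟩ := hl
  induction hq using Subgroup.closure_induction with
  | mem y hy =>
    obtain ⟨t, ht, rfl⟩ := hy
    exact ⟨t, ht, 1, one_mem _, by simp⟩
  | one => exact ⟨1, one_mem _, 1, one_mem _, by simp⟩
  | mul x y _ _ hx hy =>
    obtain ⟨t, ht, z, hz, rfl⟩ := hx
    obtain ⟨s, hs, w, hw, rfl⟩ := hy
    -- `t^l z s^l w = (t s)^l · ([s,t]^{-(l-1)/2})^l · z w`
    set c := s * t * s⁻¹ * t⁻¹ with hc
    have hcΘ : c ∈ D.DeltaTheta := D.commutator_mem_deltaTheta hs ht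
    have hchoose : l.choose 2 = l * k := by
      rw [Nat.choose_two_right, hk]
      have : (2 * k + 1) * (2 * k + 1 - 1) = 2 * ((2 * k + 1) * k) := by
        rw [Nat.add_sub_cancel]; ring
      rw [this, Nat.mul_div_cancel_left _ (by norm_num : 0 < 2)]
    have hpow : (t * s) ^ l = t ^ l * s ^ l * (c ^ k) ^ l := by
      rw [D.mul_pow_eq_pow_mul_pow_mul_commutator_pow ht hs l, hchoose, pow_mul']
    have hzs : z * s ^ l = s ^ l * z :=
      D.deltaTheta_comm_dtpTheta (D.lDeltaTheta_le l hz) (pow_mem hs l)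
    refine ⟨t * s, mul_mem ht hs, ((c ^ k) ^ l)⁻¹ * (z * w), ?_, ?_⟩
    · refine mul_mem (inv_mem ⟨c ^ k, pow_mem hcΘ k, rfl⟩) (mul_mem hz hw)
    · rw [hpow]
      calc t ^ l * z * (s ^ l * w) = t ^ l * (z * s ^ l) * w := by group
        _ = t ^ l * (s ^ l * z) * w := by rw [hzs]
        _ = t ^ l * s ^ l * (c ^ k) ^ l * (((c ^ k) ^ l)⁻¹ * (z * w)) := by group
  | inv x _ hx =>
    obtain ⟨t, ht, z, hz, rfl⟩ := hx
    have hzt : Commute z (t ^ l) :=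
      D.deltaTheta_comm_dtpTheta (D.lDeltaTheta_le l hz) (pow_mem ht l)
    refine ⟨t⁻¹, inv_mem ht, z⁻¹, inv_mem hz, ?_⟩
    rw [mul_inv_rev, inv_pow]
    exact hzt.inv_inv.eq

/-- **`Δ_Θ ∩ ⟨l-th powers⟩ = l·Δ_Θ`** for `l` odd, under the freeness guard: if `t^l z ∈ Δ_Θ` with
`z ∈ l·Δ_Θ`, then `t^l ∈ Δ_Θ`, so `t ∈ Δ_Θ` (`(Δ^tp_X)^ell` torsion-free) and `t^l ∈ l·Δ_Θ`.
[cite: MochizukiEtTh2009, Def 2.1 p.35] -/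
theorem deltaTheta_inf_powTheta (hO : D.IsEtThOrigin) (hl : Odd l) :
    D.DeltaTheta ⊓ D.powTheta l = D.lDeltaTheta l := by
  refine le_antisymm ?_ (le_inf (D.lDeltaTheta_le l) (D.lDeltaTheta_le_powTheta l))
  rintro q ⟨hqΘ, hqP⟩
  obtain ⟨t, ht, z, hz, rfl⟩ := D.exists_pow_mul_of_mem_powTheta l hl hqP
  have htl : t ^ l ∈ D.DeltaTheta := by
    have : t ^ l * z * z⁻¹ ∈ D.DeltaTheta := mul_mem hqΘ (inv_mem (D.lDeltaTheta_le l hz))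
    simpa using this
  have htΘ : t ∈ D.DeltaTheta := D.mem_deltaTheta_of_pow_mem hO ht hl.pos.ne' htl
  exact mul_mem ⟨t, htΘ, rfl⟩ hz

/-! ### The index `[Δ̄_Θ-preimage : Ker(Δ^tp_X ↠ Δ̄_X)] = [Δ_Θ : l·Δ_Θ] = l` -/

/-- The restriction of the theta quotient map to `Δ^tp_X` has image `(Δ^tp_X)^Θ`.
[cite: MochizukiEtTh2009, §1 p.12] -/
theorem range_toTheta_comp_subtype_deltaTemp :
    (D.toTheta.comp D.DeltaTemp.subtype).range = D.DtpTheta := by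
  rw [MonoidHom.range_comp, Subgroup.range_subtype]

/-- `Ker(Δ^tp_X ↠ Δ̄_X)`, as a subgroup of `Δ^tp_X`, is the pull-back of `⟨l-th powers⟩`.
[cite: MochizukiEtTh2009, Def 2.1 p.35] -/
theorem barKerTp_subgroupOf_deltaTemp :
    (D.barKerTp l).subgroupOf D.DeltaTemp = (D.powTheta l).comap (D.toTheta.comp D.DeltaTemp.subtype) := by
  ext x
  rw [Subgroup.mem_subgroupOf, Subgroup.mem_comap, D.mem_barKerTp_iff]
  exact ⟨fun h => h.2, fun h => ⟨x.2, h⟩⟩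

/-- The preimage of `Δ̄_Θ`, as a subgroup of `Δ^tp_X`, is the pull-back of `⟨l-th powers⟩ · Δ_Θ`.
[cite: MochizukiEtTh2009, Def 2.1 p.35] -/
theorem barThetaTp_subgroupOf_deltaTemp :
    (D.barThetaTp l).subgroupOf D.DeltaTemp =
      (D.powTheta l ⊔ D.DeltaTheta).comap (D.toTheta.comp D.DeltaTemp.subtype) := by
  ext x
  rw [Subgroup.mem_subgroupOf, Subgroup.mem_comap, D.mem_barThetaTp_iff]
  exact ⟨fun h => h.2, fun h => ⟨x.2, h⟩⟩

/-- **`[Δ̄_Θ-preimage : Ker(Δ^tp_X ↠ Δ̄_X)] = [Δ_Θ : l·Δ_Θ]`** for `l` odd, under the freeness guard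
(`Δ̄_Θ ≅ Δ_Θ/(Δ_Θ ∩ ⟨l-th powers⟩) = Δ_Θ/l·Δ_Θ`, "`Δ̄_Θ ≅ (ℤ/lℤ)(1)`", p. 35) — the field
`CoverData.relIndex_barKer` at the model, tempered form, reduced to the index of `l·Δ_Θ` in `Δ_Θ`.
[cite: MochizukiEtTh2009, Def 2.1 p.35] -/
theorem relIndex_barKerTp_barThetaTp (hO : D.IsEtThOrigin) (hl : Odd l) :
    (D.barKerTp l).relIndex (D.barThetaTp l) = (D.lDeltaTheta l).relIndex D.DeltaTheta := by
  haveI := D.powTheta_normal l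
  have hle : D.barThetaTp l ≤ D.DeltaTemp := D.barThetaTp_le_deltaTemp l
  rw [← Subgroup.relIndex_subgroupOf hle, D.barKerTp_subgroupOf_deltaTemp,
    D.barThetaTp_subgroupOf_deltaTemp, Subgroup.relIndex_comap, Subgroup.map_comap_eq,
    D.range_toTheta_comp_subtype_deltaTemp, inf_eq_right.2 (D.powTheta_sup_deltaTheta_le l),
    Subgroup.relIndex_sup_left, ← Subgroup.inf_relIndex_right, inf_comm,
    D.deltaTheta_inf_powTheta l hO hl]

/-- **`[Δ̄_Θ-preimage : Ker(Δ^tp_X ↠ Δ̄_X)] = l`** ("`Δ̄_Θ ≅ (ℤ/lℤ)(1)`", p. 35) for `l` odd, under the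
freeness guard and the cyclotome identification `Δ_Θ/l·Δ_Θ ≅ μ_l` of the §2 model
(`CyclotomeMod 1 l`, `index_lDeltaTheta_of_cyclotomeMod`) — the field `CoverData.relIndex_barKer` at the
model, tempered form. [cite: MochizukiEtTh2009, Def 2.1 p.35] -/
theorem relIndex_barKerTp_barThetaTp_of_cyclotomeMod (hO : D.IsEtThOrigin) {l : ℕ+}
    (hl : Odd (l : ℕ)) (μ : D.CyclotomeMod 1 l) :
    (D.barKerTp l).relIndex (D.barThetaTp l) = l := by
  rw [D.relIndex_barKerTp_barThetaTp l hO hl]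
  exact index_lDeltaTheta_of_cyclotomeMod μ

end ThetaSetting

end Literature.AnabelianGeometry.EtaleTheta

end
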